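import Summits.Ventures.HodgeRepro2.T5CyclotomicSevenClassification

/-!
# Every finite place of `K⁺` has a place of `K` above it, so row N2.2.2 needs no `w` at all
(cell pub-hodge-repro2, seat p3)

Tier-5 N2 support, rows N2.2.2 / N2.8.1 of route/T5-N2-route-3.md — the consumer-side form of files 152 / 153.
Their statements are about the route's local algebra `K⁺_v ⊗ K` but carry a place `w` of `K` above `v` as a
hypothesis (it is where the non-split case is computed). Here:

* `exists_liesOver`: every finite place `v` of `K⁺` has a place `w` of `K` above it (file 128's count
  `|primesOver v| ∈ {1, 2}`, Mathlib's `Set.nonempty_of_ncard_ne_zero`; `w ≠ 0` because `𝓞 K⁺ → 𝓞 K` is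
  injective);
* **`classification_of_place`** / `isCongruent_iff_hilbertSolvable_of_place` / `exists_two_classes_of_place`:
  files 152's statements with `w` discharged — row N2.2.2 / N2.8.1 (i) at every finite place `v` of `K⁺` from
  the datum `(θ, y)` alone;
* **`classification_K7_of_place`** / `isCongruent_iff_hilbertSolvable_K7_of_place` /
  `exists_two_classes_K7_of_place`: the same on the field of record `ℚ(ζ₇)`, with no hypothesis at all.

Mathlib + this seat's files 128 and 150–153 (with seat p4's chain through them) only; no display; no device.
§8(d): uses an L-value-free non-vanishing device: NO.
-/

namespace Summit.Ventures.HodgeRepro2.T5FinitePlaceExistsOver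

open IsDedekindDomain IsDedekindDomain.HeightOneSpectrum NumberField NumberField.IsCMField Module Matrix
open scoped TensorProduct
open Summit.Ventures.HodgeRepro2.CyclotomicSeven Summit.Ventures.HodgeRepro2.T5FinitePlaceSplitIff
  Summit.Ventures.HodgeRepro2.T5FinitePlaceSplitClassification Summit.Ventures.HodgeRepro2.T5HermitianDetClass
  Summit.Ventures.HodgeRepro2.T5HermitianClassify Summit.Ventures.HodgeRepro2.T5HilbertSymbolNorm
  Summit.Ventures.HodgeRepro2.T5FinitePlaceClassification
  Summit.Ventures.HodgeRepro2.T5CyclotomicSevenClassification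

section Exists

variable (K : Type*) [Field K] [NumberField K] [IsCMField K]
variable (v : HeightOneSpectrum (𝓞 (maximalRealSubfield K)))

/-- **Every finite place of `K⁺` has a place of `K` above it** (one or two, file 128). -/
theorem exists_liesOver : ∃ w : HeightOneSpectrum (𝓞 K), w.asIdeal.LiesOver v.asIdeal := by
  have hne : (v.asIdeal.primesOver (𝓞 K)).ncard ≠ 0 := by
    rcases ncard_primesOver_eq_one_or_two K v with h | h <;> rw [h] <;> norm_num
  obtain ⟨Q, hP, hLO⟩ := Set.nonempty_of_ncard_ne_zero hne
  have hbot : Q ≠ ⊥ := by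
    rintro rfl
    exact v.ne_bot (hLO.over.trans (RingOfIntegers.ker_algebraMap_eq_bot (maximalRealSubfield K) K))
  exact ⟨⟨Q, hP, hbot⟩, hLO⟩

end Exists

section General

variable (K : Type*) [Field K] [NumberField K] [IsCMField K]
variable {θ : maximalRealSubfield K} {y : K}
  (hθ : algebraMap (maximalRealSubfield K) K θ = y ^ 2) (hy : complexConj K y ≠ y)
variable (v : HeightOneSpectrum (𝓞 (maximalRealSubfield K)))

include hθ hy in
/-- **Row N2.2.2 at every finite place `v` of `K⁺`, from the datum `(θ, y)` alone, no place of `K` named:** on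
`K⁺_v ⊗ K` with the conjugation `1 ⊗ c`, split ⇒ any two invertible hermitian matrices are congruent; non-split ⇒
congruent iff the determinants differ by a norm. -/
theorem classification_of_place {n : Type*} [Fintype n] [DecidableEq n]
    {H H' : Matrix n n ((v.adicCompletion (maximalRealSubfield K)) ⊗[maximalRealSubfield K] K)}
    (hH : letI := tensorStarRing K v; H.IsHermitian) (hH' : letI := tensorStarRing K v; H'.IsHermitian)
    (hdet : IsUnit H.det) (hdet' : IsUnit H'.det) :
    letI := tensorStarRing K v
    (IsSquare (algebraMap (maximalRealSubfield K) (v.adicCompletion (maximalRealSubfield K)) θ) →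
        IsCongruent H H') ∧
      (¬ IsSquare (algebraMap (maximalRealSubfield K) (v.adicCompletion (maximalRealSubfield K)) θ) →
        (IsCongruent H H' ↔ ∃ u : (v.adicCompletion (maximalRealSubfield K)) ⊗[maximalRealSubfield K] K,
          u ≠ 0 ∧ H'.det = star u * u * H.det)) := by
  obtain ⟨w, hw⟩ := exists_liesOver K v
  exact classification K hθ hy v w hH hH' hdet hdet'

include hθ hy in
/-- **Row N2.8.1 (i) at a non-split place `v` of `K⁺`, no place of `K` named:** Gram matrices over `K⁺_v ⊗ K`
with `det H' = (a ⊗ 1) · det H` are congruent iff `(a, θ)_v = 1`. -/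
theorem isCongruent_iff_hilbertSolvable_of_place
    (hsq : ¬ IsSquare (algebraMap (maximalRealSubfield K) (v.adicCompletion (maximalRealSubfield K)) θ))
    {n : Type*} [Fintype n] [DecidableEq n]
    {H H' : Matrix n n ((v.adicCompletion (maximalRealSubfield K)) ⊗[maximalRealSubfield K] K)}
    (hH : letI := tensorStarRing K v; H.IsHermitian) (hH' : letI := tensorStarRing K v; H'.IsHermitian)
    (hdet : IsUnit H.det) {a : v.adicCompletion (maximalRealSubfield K)} (ha : a ≠ 0)
    (hdet' : H'.det = algebraMap (v.adicCompletion (maximalRealSubfield K))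
      ((v.adicCompletion (maximalRealSubfield K)) ⊗[maximalRealSubfield K] K) a * H.det) :
    letI := tensorStarRing K v
    IsCongruent H H' ↔
      HilbertSolvable a (algebraMap (maximalRealSubfield K) (v.adicCompletion (maximalRealSubfield K)) θ) := by
  obtain ⟨w, hw⟩ := exists_liesOver K v
  exact isCongruent_iff_hilbertSolvable_of_not_isSquare K hθ hy v w hsq hH hH' hdet ha hdet'

include hθ hy in
/-- **HKS96's «precisely two classes in each dimension» at a non-split place `v` of `K⁺`, no place of `K`
named.** -/
theorem exists_two_classes_of_place
    (hsq : ¬ IsSquare (algebraMap (maximalRealSubfield K) (v.adicCompletion (maximalRealSubfield K)) θ))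
    (m : ℕ) :
    letI := tensorStarRing K v
    ∃ H₁ H₂ : Matrix (Fin (m + 1)) (Fin (m + 1))
        ((v.adicCompletion (maximalRealSubfield K)) ⊗[maximalRealSubfield K] K),
      H₁.IsHermitian ∧ H₂.IsHermitian ∧ IsUnit H₁.det ∧ IsUnit H₂.det ∧ ¬ IsCongruent H₁ H₂ ∧
        ∀ H : Matrix (Fin (m + 1)) (Fin (m + 1))
          ((v.adicCompletion (maximalRealSubfield K)) ⊗[maximalRealSubfield K] K),
          H.IsHermitian → IsUnit H.det → IsCongruent H H₁ ∨ IsCongruent H H₂ := by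
  obtain ⟨w, hw⟩ := exists_liesOver K v
  exact exists_two_classes_of_not_isSquare K hθ hy v w hsq m

end General

section FieldOfRecord

variable (v : HeightOneSpectrum (𝓞 (maximalRealSubfield K7)))

/-- **Row N2.2.2 on `ℚ(ζ₇)` at every finite place `v` of `ℚ(ζ₇)⁺`, with no hypothesis at all:** on
`K7⁺_v ⊗ K7` with the conjugation `1 ⊗ c`, `−7` a `v`-adic square ⇒ any two invertible hermitian matrices are
congruent; otherwise congruent iff the determinants differ by a norm. -/
theorem classification_K7_of_place {n : Type*} [Fintype n] [DecidableEq n]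
    {H H' : Matrix n n ((v.adicCompletion (maximalRealSubfield K7)) ⊗[maximalRealSubfield K7] K7)}
    (hH : letI := tensorStarRing K7 v; H.IsHermitian) (hH' : letI := tensorStarRing K7 v; H'.IsHermitian)
    (hdet : IsUnit H.det) (hdet' : IsUnit H'.det) :
    letI := tensorStarRing K7 v
    (IsSquare (algebraMap (maximalRealSubfield K7) (v.adicCompletion (maximalRealSubfield K7)) (-7)) →
        IsCongruent H H') ∧
      (¬ IsSquare (algebraMap (maximalRealSubfield K7) (v.adicCompletion (maximalRealSubfield K7)) (-7)) →
        (IsCongruent H H' ↔ ∃ u : (v.adicCompletion (maximalRealSubfield K7)) ⊗[maximalRealSubfield K7] K7,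
          u ≠ 0 ∧ H'.det = star u * u * H.det)) := by
  obtain ⟨w, hw⟩ := exists_liesOver K7 v
  exact classification_K7 v w hH hH' hdet hdet'

/-- **Row N2.8.1 (i) on `ℚ(ζ₇)` at a non-split place, with no hypothesis at all.** -/
theorem isCongruent_iff_hilbertSolvable_K7_of_place
    (hsq : ¬ IsSquare (algebraMap (maximalRealSubfield K7) (v.adicCompletion (maximalRealSubfield K7)) (-7)))
    {n : Type*} [Fintype n] [DecidableEq n]
    {H H' : Matrix n n ((v.adicCompletion (maximalRealSubfield K7)) ⊗[maximalRealSubfield K7] K7)}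
    (hH : letI := tensorStarRing K7 v; H.IsHermitian) (hH' : letI := tensorStarRing K7 v; H'.IsHermitian)
    (hdet : IsUnit H.det) {a : v.adicCompletion (maximalRealSubfield K7)} (ha : a ≠ 0)
    (hdet' : H'.det = algebraMap (v.adicCompletion (maximalRealSubfield K7))
      ((v.adicCompletion (maximalRealSubfield K7)) ⊗[maximalRealSubfield K7] K7) a * H.det) :
    letI := tensorStarRing K7 v
    IsCongruent H H' ↔
      HilbertSolvable a (algebraMap (maximalRealSubfield K7) (v.adicCompletion (maximalRealSubfield K7)) (-7)) := by
  obtain ⟨w, hw⟩ := exists_liesOver K7 v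
  exact isCongruent_iff_hilbertSolvable_K7' v w hsq hH hH' hdet ha hdet'

/-- **HKS96's «precisely two classes in each dimension» on `ℚ(ζ₇)` at a non-split place, with no hypothesis at
all.** -/
theorem exists_two_classes_K7_of_place
    (hsq : ¬ IsSquare (algebraMap (maximalRealSubfield K7) (v.adicCompletion (maximalRealSubfield K7)) (-7)))
    (m : ℕ) :
    letI := tensorStarRing K7 v
    ∃ H₁ H₂ : Matrix (Fin (m + 1)) (Fin (m + 1))
        ((v.adicCompletion (maximalRealSubfield K7)) ⊗[maximalRealSubfield K7] K7),
      H₁.IsHermitian ∧ H₂.IsHermitian ∧ IsUnit H₁.det ∧ IsUnit H₂.det ∧ ¬ IsCongruent H₁ H₂ ∧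
        ∀ H : Matrix (Fin (m + 1)) (Fin (m + 1))
          ((v.adicCompletion (maximalRealSubfield K7)) ⊗[maximalRealSubfield K7] K7),
          H.IsHermitian → IsUnit H.det → IsCongruent H H₁ ∨ IsCongruent H H₂ := by
  obtain ⟨w, hw⟩ := exists_liesOver K7 v
  exact exists_two_classes_K7' v w hsq m

end FieldOfRecord

end Summit.Ventures.HodgeRepro2.T5FinitePlaceExistsOver
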